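import Literature.AlgebraicGeometry.AbelianSchemes.AbelianSchemeDualPairNormalize
import Literature.AlgebraicGeometry.AbelianSchemes.AbelianSchemeDualTransportUnit
import Literature.AlgebraicGeometry.AbelianSchemes.PolarizedAbelianSchemeWithLevel
import HarnessLib

/-!
# Polarisations survive the renormalisation of the dual pair: `λ` is a polarisation of `A` w.r.t. `D.normalize`, of the
# same type, with the same symplectic-liftable level structures

Layer `Literature/AlgebraicGeometry/AbelianSchemes`, namespaces `Literature.AlgebraicGeometry.AbelianSchemes.AbelianSchemeOver.DualPair`,
`….AbelianSchemeOver.Polarization` and `….PolarizedAbelianSchemeWithLevel`.  THEOREMS ONLY (no def, no instance, no notation, no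
`sorry`).  Cell `hodgecm-mathlib` (D-0151), repair road R2⁺ (the second normalisation `𝒫|_{X × {ε_X̂}} ≅ 𝒪` becomes a field of
the moduli triple): the ONE lemma a triple constructor needs when it replaces a raw dual pair `D = (Â, 𝒫)` by its renormalisation
★ `D.normalize = (Â, 𝒫 ⊗ (pr_A^*M)^∨)`, `M := 𝒫|_{A × {ε_Â}}` (★ `AbelianSchemeDualPairNormalize`; [MumfordFogartyKirwan1994, Ch. 6 §2
(p. 121)]: the normalised Poincaré sheaf; [MilneAV2008, I §8]).

`D.normalize` has the SAME dual abelian scheme `Â` (`normalize_hat`, `rfl`), so a homomorphism `λ : A → Â` is a candidate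
polarisation for both.  The polarisation condition [MumfordFogartyKirwan1994, Def. 6.3] reads `𝒫` only through the geometric
slices `A_s × {λ̄(x)}` (★ `IsLambdaOfAt`: `𝒫|_{A_s × {λ̄(x)}} ≅ t_x^*𝒪(Θ) ⊗ 𝒪(Θ)⁻¹` for every `Ω`-point `x` of `A_s`), and on
such a slice the twist restricts to `(M|_{A_s})^∨` with `M|_{A_s} = 𝒫|_{A_s × {ε_Â}}` — which is TRIVIAL as soon as `λ̄ = Λ(𝒪(Θ₀))`
holds at `s` for some `Θ₀` (★ `nonempty_pullback_fst_unitHatSlice_iso_of_isLambdaOfAt`: the slice at `λ̄(1) = ε_Â` is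
`𝒪(Θ₀) ⊗ 𝒪(Θ₀)⁻¹ ≅ 𝒪`; [MumfordFogartyKirwan1994, Def. 6.2] `Λ(L)(e) = 0`).  Hence, on determinant classes in `Ȟ¹(A_s, 𝒪^×)`
(★ `detClass_pullback_normalizeP`, ★ `nonempty_iso_iff_detClass_eq`):

* `DualPair.nonempty_pullback_sliceAt_normalizeP_iso_iff` — if `𝒫|_{A_s × {ε_Â}} ≅ 𝒪` then for every rank-one `L` on `A_s` and
  every point `x`: `(𝒫 ⊗ (pr_A^*M)^∨)|_{A_s × {λ̄(x)}} ≅ L ⟺ 𝒫|_{A_s × {λ̄(x)}} ≅ L`;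
* `DualPair.isLambdaOfAt_normalize_iff_of_nonempty`, **`DualPair.isLambdaOfAt_normalize_iff`** `[IsMonHom λ] (h₀ : ∃ Θ₀, IsLambdaOfAt s D λ Θ₀)`:
  `IsLambdaOfAt s D.normalize λ Θ ↔ IsLambdaOfAt s D λ Θ`, and `DualPair.isLambdaOfAt_normalize` (the forward direction from itself);
* **`Polarization.exists_normalize`**: `∃ pol′ : A.Polarization D.normalize, pol′.lam = pol.lam`; `Polarization.isLambdaOfAt_normalize_iff`
  (at algebraically closed points, hypothesis-free for a polarisation);
* `Polarization.kerPointsAt_eq_of_lam_eq`, **`Polarization.hasType_iff_of_lam_eq`** (the type `δ` [MumfordFogartyKirwan1994, App. 7A]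
  reads `λ` only), **`Polarization.isSymplecticLiftable_iff_of_lam_eq`** (symplectic-liftability [Lan2013PELCompactifications,
  Def. 1.3.6.2 / Lemma 1.3.6.6] reads `𝒫` through `IsLambdaOfAt` in hypothesis position — both directions of the `iff` are used),
  `Polarization.exists_normalize_hasType_isSymplecticLiftable` (the three clauses at once);
* **`PolarizedAbelianSchemeWithLevel.exists_pol_normalize`** — for a triple `P`: a polarisation `pol′` of `P.A` w.r.t. `P.D.normalize`
  with `pol′.lam = P.pol.lam`, `pol′.HasType δ` and `P.level.IsSymplecticLiftable pol′ δ` (so `(P.A, P.D.normalize, pol′, P.level)` is a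
  triple with `𝒫|_{X × {ε_X̂}} ≅ 𝒪`, ★ `nonempty_unitHatSlice_iso_normalize`, and the same `λ`, type and level).

HC_CM is proved only modulo the 7 printed citations until rung 0 closes; nothing here is about HC.

## References
* [MumfordFogartyKirwan1994] D. Mumford, J. Fogarty, F. Kirwan, *Geometric Invariant Theory*, 3rd ed. (1994), Ch. 6 §2
  Definitions 6.2–6.3 (p. 120), Ch. 6 §2 (p. 121) (normalised Poincaré sheaf), App. 7A (pp. 234–235).
* [MilneAV2008] J. S. Milne, *Abelian Varieties* (v2.00, 2008), I §8 pp. 36–37.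
* [Lan2013PELCompactifications] K.-W. Lan, *Arithmetic compactifications of PEL-type Shimura varieties* (2013), §1.3.6
  Def. 1.3.6.2 (p. 80), Lemma 1.3.6.6 (pp. 81–82).
* [Hartshorne1977] R. Hartshorne, *Algebraic Geometry* (1977), II Ex. 6.11 (determinant classes).
-/

noncomputable section

-- `Scheme.Modules` / the `Over`-monoidal carriers are not reducible (`(A.fibre s).toAbelianVariety.X.left = pullback A.X.hom s`
-- and `D.normalize.hat = D.hat` hold by `rfl` only), as in ★ `AbelianSchemeDualPairNormalize`.
set_option backward.isDefEq.respectTransparency false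

universe u

open CategoryTheory CategoryTheory.Limits AlgebraicGeometry MonoidalCategory

namespace Literature.AlgebraicGeometry.AbelianSchemes

namespace AbelianSchemeOver

open Literature.AlgebraicGeometry.Motives Literature.AlgebraicGeometry.AbelianVarieties
  Literature.AlgebraicGeometry.Modules
open scoped MonObj

variable {S : Scheme.{u}} {A : AbelianSchemeOver S}

namespace DualPair

variable (D : A.DualPair)

section Slices

variable {Ω : Type u} [Field Ω] (s : Spec (.of Ω) ⟶ S) (lam : A.X ⟶ D.hat.X)

/-- The slice `A_s × {λ̄(x)}` into `A ×_S Â` is the same map for `D` and for `D.normalize` (same `Â`; definitional).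
[cite: MumfordFogartyKirwan1994, Ch. 6 §2 Definition 6.2 (p. 120)] -/
theorem sliceAt_normalize (P : (A.fibre s).toAbelianVariety.Points Ω) :
    A.sliceAt s D.normalize lam P = A.sliceAt s D lam P := rfl

/-- **On a geometric slice the twist is invisible once `𝒫|_{A_s × {ε_Â}} ≅ 𝒪`**: for every rank-one `L` on `A_s` and every
`Ω`-point `x` of `A_s`, `(𝒫 ⊗ (pr_A^*M)^∨)|_{A_s × {λ̄(x)}} ≅ L ⟺ 𝒫|_{A_s × {λ̄(x)}} ≅ L` — on classes
`[slice^*𝒫] · ((A_s → A × {ε_Â})^*[𝒫])⁻¹ = [slice^*𝒫] · 1` (★ `detClass_pullback_normalizeP`, ★ `sliceAt_fst`).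
[cite: MilneAV2008, I §8 pp. 36–37] [cite: Hartshorne1977, II Ex. 6.11] -/
theorem nonempty_pullback_sliceAt_normalizeP_iso_iff
    (hM : Nonempty ((Scheme.Modules.pullback (pullback.fst A.X.hom s ≫ unitHatSlice D)).obj D.P ≅ SheafOfModules.unit _))
    (P : (A.fibre s).toAbelianVariety.Points Ω) {L : (pullback A.X.hom s).Modules} (hL : HasRank L 1) :
    Nonempty ((Scheme.Modules.pullback (A.sliceAt s D lam P)).obj D.normalizeP ≅ L) ↔
      Nonempty ((Scheme.Modules.pullback (A.sliceAt s D lam P)).obj D.P ≅ L) := by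
  have hP := D.hasRank_one
  have hP₁ := HasRank.isFiniteLocallyFree' hP
  have hN := D.hasRank_normalizeP
  have hN₁ := HasRank.isFiniteLocallyFree' hN
  have hL₁ := HasRank.isFiniteLocallyFree' hL
  obtain ⟨m⟩ := hM
  have hm : CechPic.pullback (pullback.fst A.X.hom s ≫ unitHatSlice D) (detClass hP₁) = 1 := by
    rw [← detClass_pullback (hE := hP₁),
      detClass_eq_of_iso m (hP₁.pullback _) (HasRank.isFiniteLocallyFree' hasRank_unitModule)]
    exact detClass_unitModule_eq_one _
  rw [nonempty_iso_iff_detClass_eq (hasRank_pullback _ hN) hL (hN₁.pullback _) hL₁,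
    nonempty_iso_iff_detClass_eq (hasRank_pullback _ hP) hL (hP₁.pullback _) hL₁,
    D.detClass_pullback_normalizeP _ (hN₁.pullback _), AbelianSchemeOver.sliceAt_fst_assoc, hm, inv_one, mul_one,
    detClass_pullback (hE := hP₁)]

/-- **`λ̄ = Λ(𝒪(Θ))` at `s` holds for `D.normalize` iff it holds for `D`**, given `𝒫|_{A_s × {ε_Â}} ≅ 𝒪`.
[cite: MumfordFogartyKirwan1994, Ch. 6 §2 Definition 6.2 (p. 120)] [cite: MilneAV2008, I §8 pp. 36–37] -/
theorem isLambdaOfAt_normalize_iff_of_nonempty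
    (hM : Nonempty ((Scheme.Modules.pullback (pullback.fst A.X.hom s ≫ unitHatSlice D)).obj D.P ≅ SheafOfModules.unit _))
    (Θ : CartierDivisor (A.fibre s).toAbelianVariety.X.left) :
    A.IsLambdaOfAt s D.normalize lam Θ ↔ A.IsLambdaOfAt s D lam Θ := by
  refine forall_congr' fun P => ?_
  exact D.nonempty_pullback_sliceAt_normalizeP_iso_iff s lam hM P
    (hasRank_tensorObj_one (hasRank_pullback _ (A.hasRank_lineBundleOfDivisor s Θ))
      (hasRank_dual (A.hasRank_lineBundleOfDivisor s Θ)))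

/-- **`λ̄ = Λ(𝒪(Θ))` at `s` holds for `D.normalize` iff it holds for `D`**, for a homomorphism `λ` which is `Λ(𝒪(Θ₀))` at `s`
for SOME `Θ₀` w.r.t. `D` (then `𝒫|_{A_s × {ε_Â}} = 𝒪(Θ₀) ⊗ 𝒪(Θ₀)⁻¹ ≅ 𝒪`, ★ `nonempty_pullback_fst_unitHatSlice_iso_of_isLambdaOfAt`).
[cite: MumfordFogartyKirwan1994, Ch. 6 §2 Definitions 6.2–6.3 (p. 120)] [cite: MilneAV2008, I §8 pp. 36–37] -/
theorem isLambdaOfAt_normalize_iff [IsMonHom lam]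
    (h₀ : ∃ Θ₀ : CartierDivisor (A.fibre s).toAbelianVariety.X.left, A.IsLambdaOfAt s D lam Θ₀)
    (Θ : CartierDivisor (A.fibre s).toAbelianVariety.X.left) :
    A.IsLambdaOfAt s D.normalize lam Θ ↔ A.IsLambdaOfAt s D lam Θ :=
  h₀.elim fun _ hΘ₀ =>
    D.isLambdaOfAt_normalize_iff_of_nonempty s lam (nonempty_pullback_fst_unitHatSlice_iso_of_isLambdaOfAt D s lam hΘ₀) Θ

/-- `λ̄ = Λ(𝒪(Θ))` at `s` for `D` implies the same for `D.normalize` (homomorphism `λ`).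
[cite: MumfordFogartyKirwan1994, Ch. 6 §2 Definitions 6.2–6.3 (p. 120)] -/
theorem isLambdaOfAt_normalize [IsMonHom lam] {Θ : CartierDivisor (A.fibre s).toAbelianVariety.X.left}
    (h : A.IsLambdaOfAt s D lam Θ) : A.IsLambdaOfAt s D.normalize lam Θ :=
  (D.isLambdaOfAt_normalize_iff s lam ⟨Θ, h⟩ Θ).2 h

end Slices

end DualPair

namespace Polarization

variable {D : A.DualPair} (pol : A.Polarization D)

/-- **A polarisation w.r.t. `D` is a polarisation w.r.t. `D.normalize`, with the same `λ`** ([MumfordFogartyKirwan1994, Def. 6.3]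
reads `𝒫` only on geometric slices, where the renormalising twist is trivial). Stated as an `∃` (no data definition).
[cite: MumfordFogartyKirwan1994, Ch. 6 §2 Definition 6.3 (p. 120) and Ch. 6 §2 (p. 121)] [cite: MilneAV2008, I §8 pp. 36–37] -/
theorem exists_normalize : ∃ pol' : A.Polarization D.normalize, pol'.lam = pol.lam := by
  haveI := pol.isMonHom
  exact ⟨⟨pol.lam, pol.isMonHom, fun Ω _ _ s => by
    obtain ⟨Θ, hΘ, hl⟩ := pol.exists_ample Ω s
    exact ⟨Θ, hΘ, D.isLambdaOfAt_normalize s pol.lam hl⟩⟩, rfl⟩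

/-- For a polarisation `λ` and an algebraically closed point `s`: `λ̄ = Λ(𝒪(Θ))` w.r.t. `D.normalize` iff w.r.t. `D`
(hypothesis-free: `λ̄ = Λ(𝒪(Θ₀))` for some ample `Θ₀` by Def. 6.3). [cite: MumfordFogartyKirwan1994, Ch. 6 §2 Definitions 6.2–6.3 (p. 120)] -/
theorem isLambdaOfAt_normalize_iff {Ω : Type u} [Field Ω] [IsAlgClosed Ω] (s : Spec (.of Ω) ⟶ S)
    (Θ : CartierDivisor (A.fibre s).toAbelianVariety.X.left) :
    A.IsLambdaOfAt s D.normalize pol.lam Θ ↔ A.IsLambdaOfAt s D pol.lam Θ :=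
  haveI := pol.isMonHom
  D.isLambdaOfAt_normalize_iff s pol.lam ((pol.exists_ample Ω s).imp fun _ h => h.2) Θ

/-- Two polarisations (w.r.t. `D.normalize` and `D`) with the same `λ` have the same kernels on points: `K(λ̄)` reads `λ` only.
[cite: MumfordAV1970, §13 (the group K(L))] [cite: MumfordFogartyKirwan1994, App. 7A (pp. 234–235)] -/
theorem kerPointsAt_eq_of_lam_eq (pol' : A.Polarization D.normalize) (h : pol'.lam = pol.lam) {Ω : Type u} [Field Ω]
    (s : Spec (.of Ω) ⟶ S) : pol'.kerPointsAt s = pol.kerPointsAt s := by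
  ext P
  simp only [Polarization.mem_kerPointsAt_iff]
  change A.fibrePointToLeft s P ≫ pol'.lam.left = A.fibrePointToLeft s 1 ≫ pol'.lam.left ↔
    A.fibrePointToLeft s P ≫ pol.lam.left = A.fibrePointToLeft s 1 ≫ pol.lam.left
  rw [h]

/-- **The type `δ` is unchanged** under renormalisation of the dual pair: `HasType δ` reads the kernels `K(λ̄)` only.
[cite: MumfordFogartyKirwan1994, App. 7A (pp. 234–235)] -/
theorem hasType_iff_of_lam_eq (pol' : A.Polarization D.normalize) (h : pol'.lam = pol.lam) {g : ℕ} (δ : Fin g → ℕ) :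
    pol'.HasType δ ↔ pol.HasType δ := by
  unfold Polarization.HasType
  simp only [pol.kerPointsAt_eq_of_lam_eq pol' h]

/-- **Symplectic-liftability is unchanged** under renormalisation of the dual pair: the level structure is tested against the
ample witnesses `Θ` with `λ̄ = Λ(𝒪(Θ))`, and these are the same for `D` and `D.normalize` (`isLambdaOfAt_normalize_iff`, both
directions). [cite: Lan2013PELCompactifications, §1.3.6 Def. 1.3.6.2 (p. 80) and Lemma 1.3.6.6 (pp. 81–82)]
[cite: MumfordFogartyKirwan1994, Ch. 6 §2 Definitions 6.2–6.3 (p. 120)] -/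
theorem isSymplecticLiftable_iff_of_lam_eq (pol' : A.Polarization D.normalize) (h : pol'.lam = pol.lam) {g N : ℕ}
    (φ : A.LevelStructure g N) (δ : Fin g → ℕ) :
    φ.IsSymplecticLiftable pol' δ ↔ φ.IsSymplecticLiftable pol δ := by
  simp only [LevelStructure.isSymplecticLiftable_iff]
  refine forall₄_congr fun Ω _ _ s => forall₂_congr fun Θ _ => ?_
  rw [h, pol.isLambdaOfAt_normalize_iff s Θ]

/-- **The three clauses at once**: a polarisation `pol′` w.r.t. `D.normalize` with `pol′.lam = pol.lam`, of type `δ` if `pol` is,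
and with every `pol`-symplectic-liftable level structure `pol′`-symplectic-liftable.
[cite: MumfordFogartyKirwan1994, Ch. 6 §2 Definition 6.3 (p. 120) and App. 7A (pp. 234–235)]
[cite: Lan2013PELCompactifications, §1.3.6 Def. 1.3.6.2 (p. 80)] -/
theorem exists_normalize_hasType_isSymplecticLiftable {g N : ℕ} {δ : Fin g → ℕ} (hT : pol.HasType δ)
    (φ : A.LevelStructure g N) (hφ : φ.IsSymplecticLiftable pol δ) :
    ∃ pol' : A.Polarization D.normalize, pol'.lam = pol.lam ∧ pol'.HasType δ ∧ φ.IsSymplecticLiftable pol' δ := by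
  obtain ⟨pol', h⟩ := pol.exists_normalize
  exact ⟨pol', h, (pol.hasType_iff_of_lam_eq pol' h δ).2 hT, (pol.isSymplecticLiftable_iff_of_lam_eq pol' h φ δ).2 hφ⟩

end Polarization

end AbelianSchemeOver

namespace PolarizedAbelianSchemeWithLevel

variable {g N : ℕ} {δ : Fin g → ℕ} {S : Scheme.{u}}

/-- **Every moduli triple renormalises**: for `P = (A, D, λ, σ)` there is a polarisation `pol′` of `A` w.r.t. the renormalised
dual pair `D.normalize` (★ `nonempty_unitHatSlice_iso_normalize`: `𝒫′|_{A × {ε_Â}} ≅ 𝒪`) with the SAME `λ`, the same type `δ`,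
and `σ` still symplectic-liftable — i.e. `(A, D.normalize, pol′, σ)` is a triple of [MumfordFogartyKirwan1994, Def. 7.2] with the
bi-normalised Poincaré sheaf of [MumfordFogartyKirwan1994, Ch. 6 §2 (p. 121)] and the same isomorphism-invariant data.
[cite: MumfordFogartyKirwan1994, Ch. 6 §2 (p. 121) and Ch. 7 §2 Definition 7.2 (p. 129)] [cite: MilneAV2008, I §8 pp. 36–37] -/
theorem exists_pol_normalize (P : PolarizedAbelianSchemeWithLevel g N δ S) :
    ∃ pol' : P.A.Polarization P.D.normalize,
      pol'.lam = P.pol.lam ∧ pol'.HasType δ ∧ P.level.IsSymplecticLiftable pol' δ :=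
  P.pol.exists_normalize_hasType_isSymplecticLiftable P.hasType P.level P.symplectic

end PolarizedAbelianSchemeWithLevel

end Literature.AlgebraicGeometry.AbelianSchemes

end
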